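/-
Origin: written from primary sources — R. Howe, *θ-series and invariant theory*, Proc. Sympos. Pure Math. 33.1
(1979) §2–§3 (the restriction of the oscillator representation to a see-saw partner is the tensor product of the small
oscillator representations up to a character; renormalising the small ones makes it exact); S. Kudla, *Seesaw dual
reductive pairs*, Progr. Math. 46 (1984) §1 (see-saw identity of theta kernels); S. Gelbart, J. Rogawski, Invent.
Math. 105 (1991) §3.1 Prop. 3.1.1 p. 455 and Remark p. 457 L9–13 (compatible splittings; two splittings over the same
symplectic map differ by a central character); C. Mœglin, M.-F. Vignéras, J.-L. Waldspurger, LNM 1291 (1987) Chap. 2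
II.1 (B) (the kernel of `Mp → Sp` is the scalars); A. Weil, Acta Math. 111 (1964) Chap. III n° 41 Thm 6 p. 193
(`Θ`-invariance at rational points).  Used in: Y. Liu, *Fourier–Jacobi cycles and arithmetic relative trace
formula*, Camb. J. Math. 9 (2021), proof of Thm. 4.15 (arXiv `FJcycle.tex` l. 2193–2210: «theta functions restrict
to theta functions» along `U(V⋆) × U(V⋆^⊥) ↪ U(V)`).  Adapted: no.  This file is the JUNCTION of the product-group API
of `AdelicMetaplecticSeesawCharacter` (scheme (small): twist the two small representations by `charSmall_j`) with
`AdelicMetaplecticScalarTwist` / `AdelicMetaplecticTwistCharacter` (a twisted splitting is again a splitting; two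
splittings over the same map differ by a character): the renormalised small representations COME FROM SPLITTINGS,
against which the see-saw character is identically `1`, and these splittings are unique up to one character of the
common member.  Kernel only; no records.
-/
import Literature.NumberTheory.Weil1964.AdelicMetaplecticSeesawCharacter
import Literature.NumberTheory.Weil1964.AdelicMetaplecticSeesawTwist
import Literature.NumberTheory.Weil1964.AdelicMetaplecticTwistCharacter
import HarnessLib

-- buildfix G11b-3 recipe (LEDGER B13-1/B13-3): elaborate sequentially so the trailing `attribute [implicit_reducible]`
-- block (reducibilityCoreExt is keyed to the async environment branch) is in force at `.olean` export.
set_option Elab.async false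

/-!
# Renormalising the small splittings of a see-saw: the see-saw character made identically `1`, and the
# residual freedom

Setting (the product-group section of `AdelicMetaplecticSeesawCharacter`): a number field `F`, invertible adelic
Gram matrices `T₁, T₂` (`hT₁`, `hT₂`), a see-saw product group `GV × (U₁ × U₂)` (model case: the adelic points of
`U(W) × (U(V⋆) × U(V⋆^⊥))` for an orthogonal decomposition `V = V⋆ ⊕ V⋆^⊥` of the FIRST member of a unitary dual pair
`(U(V), U(W))` — [Liu2021, proof of Thm. 4.15] — or of `U(V) × (U(W₁) × U(W₂))` for a decomposition of the second
member — [GelbartRogawski1991, §3], the tree's `UnitaryDualPairSeesawCharacter`), and three homomorphisms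

  `s : GV × (U₁ × U₂) →* Mp_ψ(W_{T₁ ⊕ T₂})ᶜᵒⁿᵗ`, `s₁ : GV × U₁ →* Mp_ψ(W_{T₁})ᶜᵒⁿᵗ`, `s₂ : GV × U₂ →* Mp_ψ(W_{T₂})ᶜᵒⁿᵗ`

LYING OVER THE SEE-SAW EMBEDDING (`hs : π(s(g,(u₁,u₂))) = π(s₁(g,u₁)) ⊕ π(s₂(g,u₂))`).  Write
`c₁ := mpCharSmall₁ s s₁ s₂ …` (`(g,u₁) ↦ λV g · λ₁ u₁`), `c₂ := mpCharSmall₂ s s₁ s₂ …` (`(g,u₂) ↦ λ₂ u₂`) for the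
characters of scheme (small), and **`s₁ ⊗ c₁ := adelicMpCont.twist … s₁ c₁`, `s₂ ⊗ c₂`** for the TWISTED SMALL SPLITTINGS
(`AdelicMetaplecticScalarTwist`; no new definition is introduced — the twists are spelled out in every statement).

* §0 `coe_mpSeesawChar₃_eq` — uniqueness of the see-saw scalar at a point (the `₃`-shaped form of
  `coe_mpSeesawChar_eq`);
* §1 **the renormalised triple `(s, s₁ ⊗ c₁, s₂ ⊗ c₂)`**: it lies over the same see-saw embedding (`hs_twistSmall`);
  the big Weil representation restricts to it ON THE NOSE —
  **`omega_apply_tensorToSum_eq_twistSmall`**: `ω(s(g,(u₁,u₂))) (Φ₁ ⊠ Φ₂) = ω((s₁ ⊗ c₁)(g,u₁)) Φ₁ ⊠ ω((s₂ ⊗ c₂)(g,u₂)) Φ₂`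
  for ALL arguments; hence its see-saw character is IDENTICALLY `1` (**`mpSeesawChar₃_twistSmall_eq_one`**, not merely
  on rational points), and the theta functional of a pure tensor is the PRODUCT of the two small theta functionals of
  the twisted splittings with no character left over (**`thetaDistLM_omega_tensorToSum_eq_mul_twistSmall`** —
  [Kudla1984, §1] / [Liu2021, l. 2204–2208] in kernel form);
* §2 **`Θ`-fixing is inherited**: at a point `(γ,δ)` where the three ORIGINAL splittings are `Θ`-fixing at
  `(γ,(1,1))`, `(γ,1)`, `(γ,1)` and at `(1,(δ,1))`, `(1,δ)` (model case: `γ`, `δ` rational and `s, s₁, s₂` compatible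
  in the sense of [GelbartRogawski1991, Prop. 3.1.1]) one has `c₁(γ,δ) = 1`, so `(s₁ ⊗ c₁)(γ,δ) = s₁(γ,δ)`
  (`twistSmall₁_apply_eq_of_mem_adelicMpTheta`) and `(s₁ ⊗ c₁)(γ,δ)` is `Θ`-fixing when `s₁(γ,δ)` is
  (`twistSmall₁_mem_adelicMpTheta`); likewise for `s₂ ⊗ c₂`.  (With `GelbartRogawski1991.SplittingDatum.IsCompatible.of_central_twist`
  this is exactly what makes the twisted small splittings again COMPATIBLE at any instance whose rational points are
  products of rational points — the instance files say so; nothing about rational structures is assumed here.)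
* §3 **the residual freedom**: if `t₁, t₂` are ANY homomorphisms over the same symplectic maps as `s₁, s₂` against
  which the big representation also restricts on the nose, then `t₁ = (s₁ ⊗ c₁) ⊗ (ν ∘ pr_{GV})` and
  `t₂ = (s₂ ⊗ c₂) ⊗ (ν⁻¹ ∘ pr_{GV})` for ONE character `ν : GV →* ℂˣ` of the common member
  (**`exists_eq_twist_fst_of_omega_apply_tensorToSum_eq`**; [GelbartRogawski1991, Remark p. 457] twice + §0) — the
  exact freedom that a normalisation of the splitting of the common member (e.g. [Liu2021]'s `μ`) later removes.

Why this file exists (cell `hodgecm-mathlib`, programme T2 = [Liu2021, Thm. 4.15], step S2c «identify the see-saw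
characters on the V-side», banked toward the later split of row III-9′; A-plan2 2026-08-28 (3)): the tree's compatible
splittings of record are chosen only up to automorphic characters (`UnitaryDualPairSeesawCharacter`, closing
paragraph: «what this file does NOT prove: `χ = 1` identically»), so Liu's inclusion «`res V(μ,e) ⊆ V⋆(μ,e)`» cannot be
obtained by COMPUTING the see-saw character of three independently chosen splittings; it is obtained by DEFINING the
small theta spaces through the twisted splittings `s_j ⊗ c_j` of §1, which §2 shows are as compatible as `s_j`, and
§3 shows are canonical up to the one character a `μ`-normalisation fixes.  Everything here is stated for an abstract
see-saw product group; the V-side instance ([Liu2021]) and the W-side instance ([GelbartRogawski1991, §3.2],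
`UnitaryDualPairSeesawSchemeSmall`) are obtained by specialising `GV, U₁, U₂, s, s₁, s₂, hs`.

KERNEL MATHEMATICS ONLY: theorems; no definition, no named fact, no `sorry`.

## References
* [Howe1979] R. Howe, *θ-series and invariant theory*, Proc. Sympos. Pure Math. 33 part 1 (1979) 275–285, §2–§3.
* [Kudla1984] S. Kudla, *Seesaw dual reductive pairs*, in: Automorphic forms of several variables, Progr. Math. 46
  (1984) 244–268, §1.
* [GelbartRogawski1991] S. Gelbart, J. Rogawski, *L-functions and Fourier–Jacobi coefficients for the unitary group
  U(3)*, Invent. Math. 105 (1991) 445–472, §3.1 Prop. 3.1.1 p. 455, Remark p. 457 L9–13.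
* [MoeglinVignerasWaldspurger1987] C. Mœglin, M.-F. Vignéras, J.-L. Waldspurger, *Correspondances de Howe sur un corps
  p-adique*, LNM 1291 (1987), Chap. 2 II.1 (B).
* [Weil1964] A. Weil, *Sur certains groupes d'opérateurs unitaires*, Acta Math. 111 (1964) 143–211, Chap. III n° 41
  Thm 6 p. 193.
* [Liu2021] Y. Liu, *Fourier–Jacobi cycles and arithmetic relative trace formula*, Camb. J. Math. 9 (2021), proof of
  Thm. 4.15 (arXiv:2102.11518, `FJcycle.tex` l. 2193–2210).
-/

set_option autoImplicit false

noncomputable section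

open scoped Matrix

open NumberField IsDedekindDomain
open Literature.RepresentationTheory Literature.RepresentationTheory.SeesawScalar Literature.NumberTheory.Automorphic

namespace Literature.NumberTheory.Weil1964

variable {F : Type} [Field F] [NumberField F]
variable {ι₁ ι₂ : Type} [Fintype ι₁] [DecidableEq ι₁] [Fintype ι₂] [DecidableEq ι₂]
variable {T₁ : Matrix ι₁ ι₁ (AdeleRing (𝓞 F) F)} {T₂ : Matrix ι₂ ι₂ (AdeleRing (𝓞 F) F)}

section Product

variable {GV U₁ U₂ : Type*} [Group GV] [Group U₁] [Group U₂]
  (s : GV × (U₁ × U₂) →* adelicMpCont F (ι₁ ⊕ ι₂) (Matrix.fromBlocks T₁ 0 0 T₂))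
  (s₁ : GV × U₁ →* adelicMpCont F ι₁ T₁) (s₂ : GV × U₂ →* adelicMpCont F ι₂ T₂)
  (hs : ∀ (g : GV) (u₁ : U₁) (u₂ : U₂),
    adelicMpCont.proj F (ι₁ ⊕ ι₂) (Matrix.fromBlocks T₁ 0 0 T₂) (s (g, (u₁, u₂))) =
      UnitaryGroup.spSum T₁ T₂
        (adelicMpCont.proj F ι₁ T₁ (s₁ (g, u₁)), adelicMpCont.proj F ι₂ T₂ (s₂ (g, u₂))))
  (hT₁ : IsUnit T₁) (hT₂ : IsUnit T₂)

/-! ## §0 Uniqueness of the see-saw scalar at a point -/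

omit [NumberField F] [DecidableEq ι₁] [DecidableEq ι₂] in
/-- generic bookkeeping (the product-group form of `SeesawScalar.coe_scalarChar_eq`, stated for the see-saw
character `seesawScalarChar` of `RepresentationTheory/SeesawScalarCharacter`): any scalar that works at `(g,(u₁,u₂))`
is `χ(g,(u₁,u₂))`.  File-private helper. [folklore] -/
private theorem coe_seesawScalarChar_eq_of_forall {R : Type*} [Field R] {S₁ S₂ S : Type*} [AddCommGroup S₁] [Module R S₁]
    [AddCommGroup S₂] [Module R S₂] [AddCommGroup S] [Module R S] (t : S₁ →ₗ[R] S₂ →ₗ[R] S)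
    (M : Representation R (GV × (U₁ × U₂)) S) (A₁ : Representation R (GV × U₁) S₁)
    (A₂ : Representation R (GV × U₂) S₂)
    (h : ∀ p : GV × (U₁ × U₂), ∃ c : R, c ≠ 0 ∧ ∀ a b,
      M p (t a b) = c • t (A₁ (seesawFst GV U₁ U₂ p) a) (A₂ (seesawSnd GV U₁ U₂ p) b))
    (hne : ∃ a b, t a b ≠ 0) {g : GV} {u₁ : U₁} {u₂ : U₂} {c : R}
    (hc : ∀ a b, M (g, (u₁, u₂)) (t a b) = c • t (A₁ (g, u₁) a) (A₂ (g, u₂) b)) :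
    (seesawScalarChar t M A₁ A₂ h hne (g, (u₁, u₂)) : R) = c :=
  SeesawScalar.coe_scalarChar_eq t M (A₁.comp (seesawFst GV U₁ U₂)) (A₂.comp (seesawSnd GV U₁ U₂)) h hne hc

/-- **Uniqueness of the see-saw scalar**, `₃`-shaped: any scalar that works at `(g,(u₁,u₂))` is
`χ(g,(u₁,u₂))` («`M` est unique à un scalaire près»). [cite: MoeglinVignerasWaldspurger1987, Chap. 2 II.1 (B)] -/
theorem coe_mpSeesawChar₃_eq {g : GV} {u₁ : U₁} {u₂ : U₂} {c : ℂ}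
    (hc : ∀ (Φ₁ : piSchwartzBruhat F ι₁) (Φ₂ : piSchwartzBruhat F ι₂),
      adelicMpCont.omega F (ι₁ ⊕ ι₂) (Matrix.fromBlocks T₁ 0 0 T₂) (s (g, (u₁, u₂))) (tensorToSum F ι₁ ι₂ Φ₁ Φ₂) =
        c • tensorToSum F ι₁ ι₂ (adelicMpCont.omega F ι₁ T₁ (s₁ (g, u₁)) Φ₁)
          (adelicMpCont.omega F ι₂ T₂ (s₂ (g, u₂)) Φ₂)) :
    (mpSeesawChar₃ s s₁ s₂ hs hT₁ hT₂ (g, (u₁, u₂)) : ℂ) = c :=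
  coe_seesawScalarChar_eq_of_forall _ _ _ _ (exists_seesaw_scalar₃ s s₁ s₂ hs hT₁ hT₂) exists_tensorToSum_ne_zero' hc

/-! ## §1 The renormalised triple `(s, s₁ ⊗ c₁, s₂ ⊗ c₂)` -/

/-- **the twisted small splittings lie over the same see-saw embedding** (`π` does not see the twist):
`π(s(g,(u₁,u₂))) = π((s₁ ⊗ c₁)(g,u₁)) ⊕ π((s₂ ⊗ c₂)(g,u₂))`.
[cite: MoeglinVignerasWaldspurger1987, Chap. 2 II.1 (B)] -/
theorem hs_twistSmall : ∀ (g : GV) (u₁ : U₁) (u₂ : U₂),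
    adelicMpCont.proj F (ι₁ ⊕ ι₂) (Matrix.fromBlocks T₁ 0 0 T₂) (s (g, (u₁, u₂))) =
      UnitaryGroup.spSum T₁ T₂
        (adelicMpCont.proj F ι₁ T₁
            (adelicMpCont.twist F ι₁ T₁ s₁ (mpCharSmall₁ s s₁ s₂ hs hT₁ hT₂) (g, u₁)),
          adelicMpCont.proj F ι₂ T₂
            (adelicMpCont.twist F ι₂ T₂ s₂ (mpCharSmall₂ s s₁ s₂ hs hT₁ hT₂) (g, u₂))) :=
  fun g u₁ u₂ =>
    (hs g u₁ u₂).trans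
      (congrArg₂ (fun x y => UnitaryGroup.spSum T₁ T₂ (x, y))
        (adelicMpCont.proj_twist s₁ (mpCharSmall₁ s s₁ s₂ hs hT₁ hT₂) (g, u₁)).symm
        (adelicMpCont.proj_twist s₂ (mpCharSmall₂ s s₁ s₂ hs hT₁ hT₂) (g, u₂)).symm)

/-- **The big Weil representation restricts to the twisted small splittings ON THE NOSE**: for ALL
`g, u₁, u₂, Φ₁, Φ₂`, `ω(s(g,(u₁,u₂))) (Φ₁ ⊠ Φ₂) = ω((s₁ ⊗ c₁)(g,u₁)) Φ₁ ⊠ ω((s₂ ⊗ c₂)(g,u₂)) Φ₂` — scheme (small) of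
`AdelicMetaplecticSeesawCharacter` read as a statement about SPLITTINGS. [cite: Howe1979, §3] -/
theorem omega_apply_tensorToSum_eq_twistSmall (g : GV) (u₁ : U₁) (u₂ : U₂) (Φ₁ : piSchwartzBruhat F ι₁)
    (Φ₂ : piSchwartzBruhat F ι₂) :
    adelicMpCont.omega F (ι₁ ⊕ ι₂) (Matrix.fromBlocks T₁ 0 0 T₂) (s (g, (u₁, u₂))) (tensorToSum F ι₁ ι₂ Φ₁ Φ₂) =
      tensorToSum F ι₁ ι₂
        (adelicMpCont.omega F ι₁ T₁
          (adelicMpCont.twist F ι₁ T₁ s₁ (mpCharSmall₁ s s₁ s₂ hs hT₁ hT₂) (g, u₁)) Φ₁)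
        (adelicMpCont.omega F ι₂ T₂
          (adelicMpCont.twist F ι₂ T₂ s₂ (mpCharSmall₂ s s₁ s₂ hs hT₁ hT₂) (g, u₂)) Φ₂) :=
  (mpSeesaw_tensorToSum_twist_small s s₁ s₂ hs hT₁ hT₂ g u₁ u₂ Φ₁ Φ₂).trans
    (congrArg₂ (fun x y => tensorToSum F ι₁ ι₂ x y)
      ((SeesawScalar.twist_apply (mpCharSmall₁ s s₁ s₂ hs hT₁ hT₂) ((adelicMpCont.omega F ι₁ T₁).comp s₁)
          (g, u₁) Φ₁).trans
        (adelicMpCont.omega_twist s₁ (mpCharSmall₁ s s₁ s₂ hs hT₁ hT₂) (g, u₁) Φ₁).symm)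
      ((SeesawScalar.twist_apply (mpCharSmall₂ s s₁ s₂ hs hT₁ hT₂) ((adelicMpCont.omega F ι₂ T₂).comp s₂)
          (g, u₂) Φ₂).trans
        (adelicMpCont.omega_twist s₂ (mpCharSmall₂ s s₁ s₂ hs hT₁ hT₂) (g, u₂) Φ₂).symm))

/-- **The see-saw character of the renormalised triple is `1` at every point.** [cite: Kudla1984, §1] -/
theorem mpSeesawChar₃_twistSmall_apply (g : GV) (u₁ : U₁) (u₂ : U₂) :
    mpSeesawChar₃ s (adelicMpCont.twist F ι₁ T₁ s₁ (mpCharSmall₁ s s₁ s₂ hs hT₁ hT₂))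
        (adelicMpCont.twist F ι₂ T₂ s₂ (mpCharSmall₂ s s₁ s₂ hs hT₁ hT₂)) (hs_twistSmall s s₁ s₂ hs hT₁ hT₂) hT₁ hT₂
        (g, (u₁, u₂)) = 1 :=
  Units.ext ((coe_mpSeesawChar₃_eq s _ _ (hs_twistSmall s s₁ s₂ hs hT₁ hT₂) hT₁ hT₂ fun Φ₁ Φ₂ =>
    (omega_apply_tensorToSum_eq_twistSmall s s₁ s₂ hs hT₁ hT₂ g u₁ u₂ Φ₁ Φ₂).trans (one_smul ℂ _).symm).trans
      Units.val_one.symm)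

/-- **The see-saw character of the renormalised triple is IDENTICALLY `1`** (as a homomorphism
`GV × (U₁ × U₂) →* ℂˣ`) — not merely on rational points. [cite: Kudla1984, §1] -/
theorem mpSeesawChar₃_twistSmall_eq_one :
    mpSeesawChar₃ s (adelicMpCont.twist F ι₁ T₁ s₁ (mpCharSmall₁ s s₁ s₂ hs hT₁ hT₂))
        (adelicMpCont.twist F ι₂ T₂ s₂ (mpCharSmall₂ s s₁ s₂ hs hT₁ hT₂)) (hs_twistSmall s s₁ s₂ hs hT₁ hT₂) hT₁ hT₂ =
      1 :=
  MonoidHom.ext fun p => mpSeesawChar₃_twistSmall_apply s s₁ s₂ hs hT₁ hT₂ p.1 p.2.1 p.2.2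

/-- **Theta functionals restrict to products of theta functionals, with no character left over**: for ALL
`g, u₁, u₂, Φ₁, Φ₂`, `Θ(ω(s(g,(u₁,u₂))) (Φ₁ ⊠ Φ₂)) = Θ(ω((s₁ ⊗ c₁)(g,u₁)) Φ₁) · Θ(ω((s₂ ⊗ c₂)(g,u₂)) Φ₂)` — the
see-saw identity of theta kernels for the twisted small SPLITTINGS ([Liu2021, l. 2204–2208] «theta functions restrict
to theta functions», abstract form). [cite: Kudla1984, §1] -/
theorem thetaDistLM_omega_tensorToSum_eq_mul_twistSmall (g : GV) (u₁ : U₁) (u₂ : U₂)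
    (Φ₁ : piSchwartzBruhat F ι₁) (Φ₂ : piSchwartzBruhat F ι₂) :
    thetaDistLM F (ι₁ ⊕ ι₂)
        (adelicMpCont.omega F (ι₁ ⊕ ι₂) (Matrix.fromBlocks T₁ 0 0 T₂) (s (g, (u₁, u₂)))
          (tensorToSum F ι₁ ι₂ Φ₁ Φ₂)) =
      thetaDistLM F ι₁
          (adelicMpCont.omega F ι₁ T₁
            (adelicMpCont.twist F ι₁ T₁ s₁ (mpCharSmall₁ s s₁ s₂ hs hT₁ hT₂) (g, u₁)) Φ₁) *
        thetaDistLM F ι₂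
          (adelicMpCont.omega F ι₂ T₂
            (adelicMpCont.twist F ι₂ T₂ s₂ (mpCharSmall₂ s s₁ s₂ hs hT₁ hT₂) (g, u₂)) Φ₂) :=
  (congrArg (thetaDistLM F (ι₁ ⊕ ι₂))
      (omega_apply_tensorToSum_eq_twistSmall s s₁ s₂ hs hT₁ hT₂ g u₁ u₂ Φ₁ Φ₂)).trans
    (thetaDistLM_tensorToSum _ _)

/-! ## §2 `Θ`-fixing is inherited by the twisted small splittings -/

/-- **`c₁(γ,δ) = 1`** when `s(γ,(1,1))`, `s₁(γ,1)`, `s₂(γ,1)` and `s(1,(δ,1))`, `s₁(1,δ)` are `Θ`-fixing pairs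
(model case: `γ ∈ GV` and `δ ∈ U₁` rational, the three splittings compatible).
[cite: Weil1964, Chap. III n° 41 Thm 6 p. 193] -/
theorem mpCharSmall₁_eq_one_of_mem_adelicMpTheta {γ : GV} {δ : U₁}
    (hγ : (s (γ, (1, 1)) : adelicMp F (ι₁ ⊕ ι₂) (Matrix.fromBlocks T₁ 0 0 T₂)) ∈
      adelicMpTheta F (ι₁ ⊕ ι₂) (Matrix.fromBlocks T₁ 0 0 T₂))
    (hγ₁ : (s₁ (γ, 1) : adelicMp F ι₁ T₁) ∈ adelicMpTheta F ι₁ T₁)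
    (hγ₂ : (s₂ (γ, 1) : adelicMp F ι₂ T₂) ∈ adelicMpTheta F ι₂ T₂)
    (hδ : (s (1, (δ, 1)) : adelicMp F (ι₁ ⊕ ι₂) (Matrix.fromBlocks T₁ 0 0 T₂)) ∈
      adelicMpTheta F (ι₁ ⊕ ι₂) (Matrix.fromBlocks T₁ 0 0 T₂))
    (hδ₁ : (s₁ (1, δ) : adelicMp F ι₁ T₁) ∈ adelicMpTheta F ι₁ T₁) :
    mpCharSmall₁ s s₁ s₂ hs hT₁ hT₂ (γ, δ) = 1 := by
  rw [mpCharSmall₁_apply_eq_mul, mpCharV_eq_one_of_mem_adelicMpTheta s s₁ s₂ hs hT₁ hT₂ hγ hγ₁ hγ₂,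
    mpChar₁_eq_one_of_mem_adelicMpTheta s s₁ s₂ hs hT₁ hT₂ hδ hδ₁, one_mul]

/-- **`c₂(γ,δ) = 1`** when `s(1,(1,δ))`, `s₂(1,δ)` are `Θ`-fixing pairs (the second small character does not see
`GV`). [cite: Weil1964, Chap. III n° 41 Thm 6 p. 193] -/
theorem mpCharSmall₂_eq_one_of_mem_adelicMpTheta (γ : GV) {δ : U₂}
    (hδ : (s (1, (1, δ)) : adelicMp F (ι₁ ⊕ ι₂) (Matrix.fromBlocks T₁ 0 0 T₂)) ∈
      adelicMpTheta F (ι₁ ⊕ ι₂) (Matrix.fromBlocks T₁ 0 0 T₂))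
    (hδ₂ : (s₂ (1, δ) : adelicMp F ι₂ T₂) ∈ adelicMpTheta F ι₂ T₂) :
    mpCharSmall₂ s s₁ s₂ hs hT₁ hT₂ (γ, δ) = 1 := by
  rw [mpCharSmall₂_apply, mpChar₂_eq_one_of_mem_adelicMpTheta s s₁ s₂ hs hT₁ hT₂ hδ hδ₂]

/-- At such a point the first twisted small splitting AGREES with `s₁`: `(s₁ ⊗ c₁)(γ,δ) = s₁(γ,δ)` (the renormalisation
is invisible at rational points). [cite: Weil1964, Chap. III n° 41 Thm 6 p. 193] -/
theorem twistSmall₁_apply_eq_of_mem_adelicMpTheta {γ : GV} {δ : U₁}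
    (hγ : (s (γ, (1, 1)) : adelicMp F (ι₁ ⊕ ι₂) (Matrix.fromBlocks T₁ 0 0 T₂)) ∈
      adelicMpTheta F (ι₁ ⊕ ι₂) (Matrix.fromBlocks T₁ 0 0 T₂))
    (hγ₁ : (s₁ (γ, 1) : adelicMp F ι₁ T₁) ∈ adelicMpTheta F ι₁ T₁)
    (hγ₂ : (s₂ (γ, 1) : adelicMp F ι₂ T₂) ∈ adelicMpTheta F ι₂ T₂)
    (hδ : (s (1, (δ, 1)) : adelicMp F (ι₁ ⊕ ι₂) (Matrix.fromBlocks T₁ 0 0 T₂)) ∈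
      adelicMpTheta F (ι₁ ⊕ ι₂) (Matrix.fromBlocks T₁ 0 0 T₂))
    (hδ₁ : (s₁ (1, δ) : adelicMp F ι₁ T₁) ∈ adelicMpTheta F ι₁ T₁) :
    adelicMpCont.twist F ι₁ T₁ s₁ (mpCharSmall₁ s s₁ s₂ hs hT₁ hT₂) (γ, δ) = s₁ (γ, δ) :=
  adelicMpCont.twist_eq_of_eq_one s₁ _
    (mpCharSmall₁_eq_one_of_mem_adelicMpTheta s s₁ s₂ hs hT₁ hT₂ hγ hγ₁ hγ₂ hδ hδ₁)

/-- At such a point the second twisted small splitting AGREES with `s₂`: `(s₂ ⊗ c₂)(γ,δ) = s₂(γ,δ)`.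
[cite: Weil1964, Chap. III n° 41 Thm 6 p. 193] -/
theorem twistSmall₂_apply_eq_of_mem_adelicMpTheta (γ : GV) {δ : U₂}
    (hδ : (s (1, (1, δ)) : adelicMp F (ι₁ ⊕ ι₂) (Matrix.fromBlocks T₁ 0 0 T₂)) ∈
      adelicMpTheta F (ι₁ ⊕ ι₂) (Matrix.fromBlocks T₁ 0 0 T₂))
    (hδ₂ : (s₂ (1, δ) : adelicMp F ι₂ T₂) ∈ adelicMpTheta F ι₂ T₂) :
    adelicMpCont.twist F ι₂ T₂ s₂ (mpCharSmall₂ s s₁ s₂ hs hT₁ hT₂) (γ, δ) = s₂ (γ, δ) :=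
  adelicMpCont.twist_eq_of_eq_one s₂ _ (mpCharSmall₂_eq_one_of_mem_adelicMpTheta s s₁ s₂ hs hT₁ hT₂ γ hδ hδ₂)

/-- **`Θ`-fixing is inherited by `s₁ ⊗ c₁`**: if moreover `s₁(γ,δ)` is a `Θ`-fixing pair, so is `(s₁ ⊗ c₁)(γ,δ)`
(model case: the twisted small splitting carries rational points of the small pair into Weil's `r_F(Sp_F)` whenever
`s₁` does). [cite: Weil1964, Chap. III n° 41 Thm 6 p. 193] -/
theorem twistSmall₁_mem_adelicMpTheta {γ : GV} {δ : U₁}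
    (hγ : (s (γ, (1, 1)) : adelicMp F (ι₁ ⊕ ι₂) (Matrix.fromBlocks T₁ 0 0 T₂)) ∈
      adelicMpTheta F (ι₁ ⊕ ι₂) (Matrix.fromBlocks T₁ 0 0 T₂))
    (hγ₁ : (s₁ (γ, 1) : adelicMp F ι₁ T₁) ∈ adelicMpTheta F ι₁ T₁)
    (hγ₂ : (s₂ (γ, 1) : adelicMp F ι₂ T₂) ∈ adelicMpTheta F ι₂ T₂)
    (hδ : (s (1, (δ, 1)) : adelicMp F (ι₁ ⊕ ι₂) (Matrix.fromBlocks T₁ 0 0 T₂)) ∈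
      adelicMpTheta F (ι₁ ⊕ ι₂) (Matrix.fromBlocks T₁ 0 0 T₂))
    (hδ₁ : (s₁ (1, δ) : adelicMp F ι₁ T₁) ∈ adelicMpTheta F ι₁ T₁)
    (h : (s₁ (γ, δ) : adelicMp F ι₁ T₁) ∈ adelicMpTheta F ι₁ T₁) :
    (adelicMpCont.twist F ι₁ T₁ s₁ (mpCharSmall₁ s s₁ s₂ hs hT₁ hT₂) (γ, δ) : adelicMp F ι₁ T₁) ∈
      adelicMpTheta F ι₁ T₁ := by
  rw [twistSmall₁_apply_eq_of_mem_adelicMpTheta s s₁ s₂ hs hT₁ hT₂ hγ hγ₁ hγ₂ hδ hδ₁]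
  exact h

/-- **`Θ`-fixing is inherited by `s₂ ⊗ c₂`**. [cite: Weil1964, Chap. III n° 41 Thm 6 p. 193] -/
theorem twistSmall₂_mem_adelicMpTheta (γ : GV) {δ : U₂}
    (hδ : (s (1, (1, δ)) : adelicMp F (ι₁ ⊕ ι₂) (Matrix.fromBlocks T₁ 0 0 T₂)) ∈
      adelicMpTheta F (ι₁ ⊕ ι₂) (Matrix.fromBlocks T₁ 0 0 T₂))
    (hδ₂ : (s₂ (1, δ) : adelicMp F ι₂ T₂) ∈ adelicMpTheta F ι₂ T₂)
    (h : (s₂ (γ, δ) : adelicMp F ι₂ T₂) ∈ adelicMpTheta F ι₂ T₂) :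
    (adelicMpCont.twist F ι₂ T₂ s₂ (mpCharSmall₂ s s₁ s₂ hs hT₁ hT₂) (γ, δ) : adelicMp F ι₂ T₂) ∈
      adelicMpTheta F ι₂ T₂ := by
  rw [twistSmall₂_apply_eq_of_mem_adelicMpTheta s s₁ s₂ hs hT₁ hT₂ γ hδ hδ₂]
  exact h

/-! ## §3 The residual freedom: one character of the common member -/

/-- bookkeeping: two characters `η₁` of `GV × U₁` and `η₂` of `GV × U₂` with `η₁(g,u₁) · η₂(g,u₂) = 1` for all
`g, u₁, u₂` are `ν ∘ pr_{GV}` and `ν⁻¹ ∘ pr_{GV}` for `ν := η₁(·,1)`.  File-private helper. [folklore] -/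
private theorem exists_eq_comp_fst_of_forall_mul_eq_one {C : Type*} [CommGroup C] (η₁ : GV × U₁ →* C)
    (η₂ : GV × U₂ →* C) (h : ∀ (g : GV) (u₁ : U₁) (u₂ : U₂), η₁ (g, u₁) * η₂ (g, u₂) = 1) :
    ∃ ν : GV →* C, η₁ = ν.comp (MonoidHom.fst GV U₁) ∧ η₂ = ν⁻¹.comp (MonoidHom.fst GV U₂) := by
  refine ⟨η₁.comp (MonoidHom.inl GV U₁), MonoidHom.ext fun p => ?_, MonoidHom.ext fun p => ?_⟩
  · obtain ⟨g, u₁⟩ := p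
    have h₁ : η₁ (1, u₁) = 1 := by
      have h' := h 1 u₁ 1
      rwa [show ((1 : GV), (1 : U₂)) = (1 : GV × U₂) from rfl, map_one, mul_one] at h'
    have hmul : ((g, u₁) : GV × U₁) = (g, 1) * (1, u₁) := by
      rw [Prod.mk_mul_mk, mul_one, one_mul]
    rw [MonoidHom.comp_apply, MonoidHom.comp_apply, MonoidHom.inl_apply]
    show η₁ (g, u₁) = η₁ (g, 1)
    rw [hmul, map_mul, h₁, mul_one]
  · obtain ⟨g, u₂⟩ := p
    have h₂ : η₂ (1, u₂) = 1 := by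
      have h' := h 1 1 u₂
      rwa [show ((1 : GV), (1 : U₁)) = (1 : GV × U₁) from rfl, map_one, one_mul] at h'
    have hg : η₂ (g, 1) = (η₁ (g, 1))⁻¹ := eq_inv_of_mul_eq_one_right (h g 1 1)
    have hmul : ((g, u₂) : GV × U₂) = (g, 1) * (1, u₂) := by
      rw [Prod.mk_mul_mk, mul_one, one_mul]
    rw [MonoidHom.comp_apply, MonoidHom.inv_apply, MonoidHom.comp_apply, MonoidHom.inl_apply]
    show η₂ (g, u₂) = (η₁ (g, 1))⁻¹
    rw [hmul, map_mul, h₂, mul_one, hg]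

-- heartbeat cliff (ops-buildfix B30 policy): passes at the default 200k but not at 160k; budget doubled, proof unchanged.
set_option maxHeartbeats 400000 in
/-- **The residual freedom.**  Let `t₁ : GV × U₁ →* Mp_ψ(W_{T₁})ᶜᵒⁿᵗ`, `t₂ : GV × U₂ →* Mp_ψ(W_{T₂})ᶜᵒⁿᵗ` lie over the
same symplectic maps as `s₁, s₂` and suppose the big Weil representation ALSO restricts to `(t₁, t₂)` on the nose:
`ω(s(g,(u₁,u₂))) (Φ₁ ⊠ Φ₂) = ω(t₁(g,u₁)) Φ₁ ⊠ ω(t₂(g,u₂)) Φ₂` for all arguments.  Then there is ONE character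
`ν : GV →* ℂˣ` of the common member with `t₁ = (s₁ ⊗ c₁) ⊗ (ν ∘ pr_{GV})` and `t₂ = (s₂ ⊗ c₂) ⊗ (ν⁻¹ ∘ pr_{GV})`.
[cite: GelbartRogawski1991, §3.1 Remark p. 457 L9–13] -/
theorem exists_eq_twist_fst_of_omega_apply_tensorToSum_eq {t₁ : GV × U₁ →* adelicMpCont F ι₁ T₁}
    {t₂ : GV × U₂ →* adelicMpCont F ι₂ T₂}
    (ht₁ : ∀ p : GV × U₁, adelicMpCont.proj F ι₁ T₁ (s₁ p) = adelicMpCont.proj F ι₁ T₁ (t₁ p))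
    (ht₂ : ∀ p : GV × U₂, adelicMpCont.proj F ι₂ T₂ (s₂ p) = adelicMpCont.proj F ι₂ T₂ (t₂ p))
    (h : ∀ (g : GV) (u₁ : U₁) (u₂ : U₂) (Φ₁ : piSchwartzBruhat F ι₁) (Φ₂ : piSchwartzBruhat F ι₂),
      adelicMpCont.omega F (ι₁ ⊕ ι₂) (Matrix.fromBlocks T₁ 0 0 T₂) (s (g, (u₁, u₂))) (tensorToSum F ι₁ ι₂ Φ₁ Φ₂) =
        tensorToSum F ι₁ ι₂ (adelicMpCont.omega F ι₁ T₁ (t₁ (g, u₁)) Φ₁)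
          (adelicMpCont.omega F ι₂ T₂ (t₂ (g, u₂)) Φ₂)) :
    ∃ ν : GV →* ℂˣ,
      t₁ = adelicMpCont.twist F ι₁ T₁
          (adelicMpCont.twist F ι₁ T₁ s₁ (mpCharSmall₁ s s₁ s₂ hs hT₁ hT₂)) (ν.comp (MonoidHom.fst GV U₁)) ∧
      t₂ = adelicMpCont.twist F ι₂ T₂
          (adelicMpCont.twist F ι₂ T₂ s₂ (mpCharSmall₂ s s₁ s₂ hs hT₁ hT₂)) (ν⁻¹.comp (MonoidHom.fst GV U₂)) := by
  -- the twisted small splittings `s_j ⊗ c_j` and the `t_j` lie over the same symplectic maps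
  have hp₁ : ∀ p : GV × U₁,
      adelicMpCont.proj F ι₁ T₁ (adelicMpCont.twist F ι₁ T₁ s₁ (mpCharSmall₁ s s₁ s₂ hs hT₁ hT₂) p) =
        adelicMpCont.proj F ι₁ T₁ (t₁ p) := fun p =>
    (adelicMpCont.proj_twist s₁ (mpCharSmall₁ s s₁ s₂ hs hT₁ hT₂) p).trans (ht₁ p)
  have hp₂ : ∀ p : GV × U₂,
      adelicMpCont.proj F ι₂ T₂ (adelicMpCont.twist F ι₂ T₂ s₂ (mpCharSmall₂ s s₁ s₂ hs hT₁ hT₂) p) =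
        adelicMpCont.proj F ι₂ T₂ (t₂ p) := fun p =>
    (adelicMpCont.proj_twist s₂ (mpCharSmall₂ s s₁ s₂ hs hT₁ hT₂) p).trans (ht₂ p)
  -- hence they differ by characters `η₁`, `η₂` [GelbartRogawski1991, Remark p. 457]
  refine (adelicMpCont.exists_eq_twist _ _ hT₁ hp₁).elim fun η₁ hη₁ => ?_
  refine (adelicMpCont.exists_eq_twist _ _ hT₂ hp₂).elim fun η₂ hη₂ => ?_
  -- comparing the two on-the-nose restrictions: `η₁(g,u₁) η₂(g,u₂) = 1`
  have key : ∀ (g : GV) (u₁ : U₁) (u₂ : U₂), η₁ (g, u₁) * η₂ (g, u₂) = 1 := fun g u₁ u₂ => by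
    have hc : (mpSeesawChar₃ s (adelicMpCont.twist F ι₁ T₁ s₁ (mpCharSmall₁ s s₁ s₂ hs hT₁ hT₂))
        (adelicMpCont.twist F ι₂ T₂ s₂ (mpCharSmall₂ s s₁ s₂ hs hT₁ hT₂)) (hs_twistSmall s s₁ s₂ hs hT₁ hT₂) hT₁ hT₂
        (g, (u₁, u₂)) : ℂ) = ((η₁ (g, u₁) : ℂˣ) : ℂ) * ((η₂ (g, u₂) : ℂˣ) : ℂ) :=
      coe_mpSeesawChar₃_eq s _ _ (hs_twistSmall s s₁ s₂ hs hT₁ hT₂) hT₁ hT₂ fun Φ₁ Φ₂ =>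
        (h g u₁ u₂ Φ₁ Φ₂).trans
          ((congrArg₂ (fun x y => tensorToSum F ι₁ ι₂ x y)
              (adelicMpCont.omega_eq_smul_of_eq_twist hη₁ (g, u₁) Φ₁)
              (adelicMpCont.omega_eq_smul_of_eq_twist hη₂ (g, u₂) Φ₂)).trans
            (tensorToSum_smul_smul _ _ _ _))
    have h1 : (mpSeesawChar₃ s (adelicMpCont.twist F ι₁ T₁ s₁ (mpCharSmall₁ s s₁ s₂ hs hT₁ hT₂))
        (adelicMpCont.twist F ι₂ T₂ s₂ (mpCharSmall₂ s s₁ s₂ hs hT₁ hT₂)) (hs_twistSmall s s₁ s₂ hs hT₁ hT₂) hT₁ hT₂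
        (g, (u₁, u₂)) : ℂ) = 1 :=
      (congrArg Units.val (mpSeesawChar₃_twistSmall_apply s s₁ s₂ hs hT₁ hT₂ g u₁ u₂)).trans Units.val_one
    exact Units.ext ((Units.val_mul _ _).trans ((hc.symm.trans h1).trans Units.val_one.symm))
  obtain ⟨ν, hν₁, hν₂⟩ := exists_eq_comp_fst_of_forall_mul_eq_one η₁ η₂ key
  exact ⟨ν,
    hη₁.trans (congrArg (fun η => adelicMpCont.twist F ι₁ T₁
      (adelicMpCont.twist F ι₁ T₁ s₁ (mpCharSmall₁ s s₁ s₂ hs hT₁ hT₂)) η) hν₁),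
    hη₂.trans (congrArg (fun η => adelicMpCont.twist F ι₂ T₂
      (adelicMpCont.twist F ι₂ T₂ s₂ (mpCharSmall₂ s s₁ s₂ hs hT₁ hT₂)) η) hν₂)⟩

end Product

/-! ### Build-lane note (ops-buildfix G11b-3 recipe v2, LEDGER B13-1/B14-5/B14-7, as in `AdelicMetaplecticSeesawCharacter`)
`lean -o` (the hub build lane, never `lean`/the gate check) runs Lean 4.32's library-suggestion indexers over the
statement of every local theorem constant that is not a denied premise; on this family's statements (very large
dependent binder telescopes through `Mp_ψ(W_𝔸)ᶜᵒⁿᵗ` / `mpSeesawChar₃` / `adelicMpCont.twist`) that fold runs far past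
the check farm's build window (incident G11b-3, run/shared/lean/ops/buildfix/G11b-3-DOSSIER.md).  `isDeniedPremise`
skips `[implicit_reducible]` constants before any fold, and the status is inert on theorems (Meta never unfolds
`thmInfo`); with `set_option Elab.async false` (file header) the file-final attribute is in force at export.  No statement or
proof is changed (append to p633466; hygiene re-land: `Elab.async false` + non-local attribute, as in the served siblings). -/
set_option allowUnsafeReducibility true in
attribute [implicit_reducible]
  coe_seesawScalarChar_eq_of_forall
  coe_mpSeesawChar₃_eq
  hs_twistSmall
  omega_apply_tensorToSum_eq_twistSmall
  mpSeesawChar₃_twistSmall_apply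
  mpSeesawChar₃_twistSmall_eq_one
  thetaDistLM_omega_tensorToSum_eq_mul_twistSmall
  mpCharSmall₁_eq_one_of_mem_adelicMpTheta
  mpCharSmall₂_eq_one_of_mem_adelicMpTheta
  twistSmall₁_apply_eq_of_mem_adelicMpTheta
  twistSmall₂_apply_eq_of_mem_adelicMpTheta
  twistSmall₁_mem_adelicMpTheta
  twistSmall₂_mem_adelicMpTheta
  exists_eq_comp_fst_of_forall_mul_eq_one
  exists_eq_twist_fst_of_omega_apply_tensorToSum_eq

end Literature.NumberTheory.Weil1964

end
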